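import Summits.FinalStateConjecture.FinalStateConjecture.Theorems.PhotonSphereChannelsUniformPhotonSphereChannelsRefutation

/-!
# `WindowedShellChannels` (crux stmt-FinalStateConjecture-14085, route `PhotonSphereChannels`):
# the window lag `h` is load-bearing — with sharp cones (`h = 0`) the statement is FALSE at every
# mass, every shell half-width and every constant (negative-side support, refuter crux-attack seat)

`WindowedShellChannels` claims: `∀ M > 0, ∀ ρ > 0, ∃ h ≥ 0, ∃ c > 0`, for every tortoise radius
function, `s ≤ 2 ≤ …`, `s ≤ ℓ`, and every global `C²` Regge–Wheeler solution `ψ` whose Cauchy data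
vanish on the closed shell `{|x − xc| ≤ ρ}`,
`c · E_total[ψ](0) ≤ liminf_{t→+∞} E[ψ; {ρ − h + |t| < |x − xc|}] + liminf_{t→−∞} (same)`.

Here we record, sorry-free, that the LAG cannot be dropped:

* `sharp_cone_fails` — for every `M > 0`, `ρ > 0` and `c > 0` there is (at `xc = 0`,
  `r = tortoiseRadius`, `s = 2`, `ℓ = m⁴`) a global `C²` Regge–Wheeler solution with data `(0, g)`,
  `g` a `C²` plateau bump of width `3/m³` flush below the near edge `−ρ` (so the data vanish on the
  closed shell), for which `c · E_total(0) ≤ E⁺(ρ) + E⁻(ρ)` FAILS: the frozen velocity packet of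
  `FrozenPacket.frozen_packet_main` (the K1 refutation technology) has `E_total(0) ≥ ∫ g² > 0` but
  both sharp-cone channel energies `≤ (c/4) ∫ g²`, because over the time `T = 3/m³` the light-speed
  edge `−ρ − |t|` sweeps past the packet while the packet stays put, and exterior energies are
  monotone in `|t|` (`RW.exteriorEnergy_antitoneOn_rw`).
* `windowedShellChannels_false_without_lag` — hence the `h = 0` specialisation of the crux (stated
  inline; no proposition is defined under `Summits/`) is false.

Moral for provers: any proof of `WindowedShellChannels` must use a positive lag `h(M, ρ) > 0`
(the planner's heuristics: `h > 4M ln 2` from the Rindler midpoint law on the near side, and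
`h >` the periapsis retarded-time lag at the far edge); the support hypothesis alone does not
make sharp cones work, even without any kernel. This file does NOT refute the crux.
-/

noncomputable section

set_option linter.dupNamespace false

namespace Summit.FinalStateConjecture.FinalStateConjecture.Theorems.WindowedShellChannels.Negative

open Literature.Geometry.Lorentzian Literature.Geometry.Lorentzian.ReggeWheeler
open Summit.FinalStateConjecture.FinalStateConjecture.Theorems.FrozenPacket
open Summit.FinalStateConjecture.FinalStateConjecture.Theorems.Blindness
open MeasureTheory Filter Set Function
open scoped ENNReal Topology

/-- **Sharp cones fail for shell-supported data at every `(M, ρ, c)`.** For every `M > 0`, `ρ > 0`,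
`c > 0` there are a tortoise radius function (`xc = 0`), `ℓ ≥ 2` and a global `C²` spin-2
Regge–Wheeler solution whose Cauchy data vanish on `{|x| ≤ ρ}` such that
`c · E_total(0) ≤ E⁺(ρ) + E⁻(ρ)` is false (frozen velocity packets flush below `−ρ`). -/
theorem sharp_cone_fails {M : ℝ} (hM : 0 < M) {ρ : ℝ} (hρ : 0 < ρ) {c : ℝ} (hc : 0 < c) :
    ∃ (r : ℝ → ℝ) (ℓ : ℕ) (ψ : ℝ → ℝ → ℝ), IsTortoiseRadius M r 0 ∧ 2 ≤ ℓ ∧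
      IsRWSolution M 2 ℓ r ψ ∧ CauchyDataSupportedOn ψ {x : ℝ | ρ < |x - 0|} ∧
      ¬ (ENNReal.ofReal c * totalEnergy (linePotential M 2 ℓ r) ψ 0 ≤
          channelEnergy (linePotential M 2 ℓ r) 0 ρ ψ atTop +
            channelEnergy (linePotential M 2 ℓ r) 0 ρ ψ atBot) := by
  set r : ℝ → ℝ := tortoiseRadius hM 0 with hr_def
  have hr : IsTortoiseRadius M r 0 := isTortoiseRadius_tortoiseRadius hM 0
  -- near edge `xe = 0 − ρ`
  set xe : ℝ := 0 - ρ with hxe_def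
  -- the bump, the constants of the potential on `[xe − 3, xe]`, and the scale `m`
  obtain ⟨B, hB, h0l, h0r, h1, h01, K₂, hK₂, hB2⟩ := exists_profile
  obtain ⟨f₀, C₀, C₁, hf₀, hC₀, hC₁, hKV⟩ :=
    potential_compact_bounds hM hr.two_mul_lt hr.hasDerivAt (a := xe - 3) (b := xe) (by linarith)
  have hε : 0 < c / 4 := by positivity
  obtain ⟨m, hm⟩ := exists_nat_gt (max 2
    (max (2 * C₀ / f₀) (Real.sqrt (108 * (9 * C₁ + K₂) ^ 2 / (c / 4 * f₀)))))
  have hm2r : (2 : ℝ) < m := lt_of_le_of_lt (le_max_left _ _) hm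
  have hm2 : 2 ≤ m := by
    have : (2 : ℕ) < m := by exact_mod_cast hm2r
    omega
  have hm0 : (0 : ℝ) < m := by linarith
  have hmC : 2 * C₀ / f₀ ≤ m := (lt_of_le_of_lt ((le_max_left _ _).trans (le_max_right _ _)) hm).le
  have hmε : 108 * (9 * C₁ + K₂) ^ 2 / (c / 4 * f₀) ≤ (m : ℝ) ^ 2 := by
    have h := lt_of_le_of_lt ((le_max_right _ _).trans (le_max_right _ _)) hm
    exact ((Real.sqrt_lt' hm0).1 h).le
  have hℓ2 : 2 ≤ m ^ 4 := le_trans hm2 (Nat.le_self_pow (by norm_num) m)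
  -- the frozen velocity packet
  obtain ⟨g, α, T, hg2, -, hT0, hedge, -, -, hg0r, hgint, hgpos, ψ, hψ2, hsol, hψ0, hψ1,
      hsupp, he0, hInt, hplus, hminus⟩ :=
    frozen_packet_main hM hr.two_mul_lt hr.hasDerivAt xe hε hB h0l h0r h1 h01 hK₂ hB2 hf₀ hC₁
      (fun ℓ => (hKV ℓ).1) (fun ℓ => (hKV ℓ).2) hm2 hmC hmε (m ^ 4) rfl
      (linePotential M 2 (m ^ 4) r) rfl
  have hψsol : IsRWSolution M 2 (m ^ 4) r ψ := ⟨hψ2, fun z => hsol z.1 z.2⟩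
  -- the Cauchy data `(0, g)` vanish on the closed shell `{|x| ≤ ρ}` (indeed on `[−ρ, ∞)`)
  have hdata : CauchyDataSupportedOn ψ {x : ℝ | ρ < |x - 0|} := by
    intro x hx
    simp only [mem_setOf_eq, sub_zero, not_lt] at hx
    refine ⟨hψ0 x, ?_⟩
    rw [hψ1 x]
    exact hg0r x (by rw [hxe_def]; linarith [neg_abs_le x])
  refine ⟨r, m ^ 4, ψ, hr, hℓ2, hψsol, hdata, fun hCI => ?_⟩
  -- upper bounds on the channel energies: monotonicity + the packet bound at `±T`
  have hmono := RW.exteriorEnergy_antitoneOn_rw hr hℓ2 hψsol 0 hρ.le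
  obtain ⟨hup, hdown⟩ := channelEnergy_le_of_antitone hmono hT0.le
  have hedgeT : 0 - ρ - |T| ≤ α := by rw [abs_of_pos hT0]; exact hedge
  have hedgeT' : 0 - ρ - |(-T)| ≤ α := by rw [abs_neg, abs_of_pos hT0]; exact hedge
  have hup' := hup.trans (exteriorEnergy_le_of_near hρ.le hedgeT hψ2 hsupp (he0 T) (hInt T) hplus)
  have hdown' := hdown.trans
    (exteriorEnergy_le_of_near hρ.le hedgeT' hψ2 hsupp (he0 (-T)) (hInt (-T)) hminus)
  -- lower bound on the total energy at `t = 0`: `∫ g²`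
  have hVnn : ∀ x, 0 ≤ linePotential M 2 (m ^ 4) r x := fun x =>
    linePotential_nonneg hM.le hℓ2 hr.two_mul_lt x
  have hlow : ENNReal.ofReal (∫ x, g x ^ 2) ≤ totalEnergy (linePotential M 2 (m ^ 4) r) ψ 0 := by
    unfold totalEnergy
    rw [ofReal_integral_eq_lintegral_ofReal hgint (ae_of_all _ fun x => sq_nonneg (g x))]
    refine lintegral_mono fun x => ENNReal.ofReal_le_ofReal ?_
    unfold energyDensity
    rw [hψ1 x]
    nlinarith [sq_nonneg (deriv (ψ 0) x), mul_nonneg (hVnn x) (sq_nonneg (ψ 0 x))]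
  -- contradiction
  set E₀ : ℝ := ∫ x, g x ^ 2 with hE₀_def
  have key : ENNReal.ofReal (c * E₀) ≤ ENNReal.ofReal (c / 4 * E₀ + c / 4 * E₀) := by
    calc ENNReal.ofReal (c * E₀) = ENNReal.ofReal c * ENNReal.ofReal E₀ := ENNReal.ofReal_mul hc.le
      _ ≤ ENNReal.ofReal c * totalEnergy (linePotential M 2 (m ^ 4) r) ψ 0 := by gcongr
      _ ≤ _ := hCI
      _ ≤ ENNReal.ofReal (c / 4 * E₀) + ENNReal.ofReal (c / 4 * E₀) := add_le_add hup' hdown'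
      _ = ENNReal.ofReal (c / 4 * E₀ + c / 4 * E₀) :=
          (ENNReal.ofReal_add (by positivity) (by positivity)).symm
  have key' := (ENNReal.ofReal_le_ofReal_iff (by positivity)).1 key
  nlinarith [mul_pos hc hgpos]

/-- **The `h = 0` specialisation of `WindowedShellChannels` is false**: there is no
`c = c(M, ρ) > 0` with `c · E_total(0) ≤ E⁺(ρ) + E⁻(ρ)` (SHARP cones from the shell edges) for all
shell-supported Regge–Wheeler data — already at any single `(M, ρ)`, by `sharp_cone_fails`.
The proposition negated is the crux with `∃ h, 0 ≤ h ∧` deleted and `ρ − h` replaced by `ρ`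
(everything else verbatim). -/
theorem windowedShellChannels_false_without_lag :
    ¬ (∀ M : ℝ, 0 < M → ∀ ρ : ℝ, 0 < ρ → ∃ c : ℝ, 0 < c ∧ ∀ (r : ℝ → ℝ) (xc : ℝ),
        IsTortoiseRadius M r xc → ∀ (s ℓ : ℕ), s ≤ 2 → s ≤ ℓ → ∀ ψ : ℝ → ℝ → ℝ,
        IsRWSolution M s ℓ r ψ → CauchyDataSupportedOn ψ {x : ℝ | ρ < |x - xc|} →
        ENNReal.ofReal c * totalEnergy (linePotential M s ℓ r) ψ 0 ≤
          channelEnergy (linePotential M s ℓ r) xc ρ ψ atTop +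
            channelEnergy (linePotential M s ℓ r) xc ρ ψ atBot) := by
  intro hK
  obtain ⟨c, hc, H⟩ := hK 1 one_pos 1 one_pos
  obtain ⟨r, ℓ, ψ, hr, hℓ2, hψsol, hdata, hfail⟩ := sharp_cone_fails one_pos one_pos hc
  exact hfail (H r 0 hr 2 ℓ le_rfl hℓ2 ψ hψsol hdata)

end Summit.FinalStateConjecture.FinalStateConjecture.Theorems.WindowedShellChannels.Negative

end
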